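import Literature.NumberTheory.Sieve.QuadraticRootsLevelForms
import Mathlib.GroupTheory.DoubleCoset
import HarnessLib

/-!
# Classes of level forms: reduction, stabilisers, and `Γ∞`-classes as double cosets (DFI §2, any sign)

Topic `Literature/NumberTheory/Sieve`, third file of the arithmetic trunk common to W. Duke,
J. B. Friedlander, H. Iwaniec, Ann. of Math. 141 (1995), §2 (`Δ < 0`) and Á. Tóth, IMRN 2000
(`Δ > 0`) (`QuadraticRootsLevelForms.lean`: roots `↔` `T`-reduced level forms;
`QuadraticRootsLevelCosets.lean`: `O(τ(q))` level cosets per class).  DFI group the forms of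
their (12) into finitely many classes `Λ` ("the number of classes of `Γ`-equivalent integral forms
is finite", p. 427) and write the sum over the forms of one class as a sum over `σ ∈ Γ_z∖Γ`
modulo `Γ∞` (the Poincaré series (14)).  This file supplies, for integral forms of any non-square
discriminant (both signs), exactly that bookkeeping — everything proved:

* **reduction** (`IsLagrangeReduced`: `|B| ≤ |A| ≤ |C|`; `exists_smul_isLagrangeReduced`;
  `three_mul_sq_le_of_isLagrangeReduced`: `3A² ≤ |Δ|`), whence a finite set
  `classReps Δ` meeting every `SL₂(ℤ)`-class of forms of discriminant `Δ`
  (`exists_mem_classReps`) and a canonical class representative `rep Q ∈ classReps (disc Q)`,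
  constant on classes (`rep_smul`) — the finiteness of the class number in the form needed;
* **stabilisers** `stab R ≤ SL₂(ℤ)` (`−1 ∈ stab R`; `smul_eq_smul_iff`: `R·ξ = R·ξ' ↔ ξ'ξ⁻¹ ∈ stab R`);
* **`Γ∞`-classes in a class as double cosets**: with `tred Q = Q·T^{tExp Q}` the `T`-reduced
  translate, `ξ ↦ tred (R·ξ)` induces a bijection
  `dcEquiv R : stab R ∖ SL₂(ℤ) ∕ ⟨T⟩ ≃ {T-reduced forms in the class of R}` (`DoubleCoset.Quotient`);
  for a FINITE stabiliser (the definite case) `s ↦ sξ⟨T⟩` is injective on `stab R`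
  (`mul_mk_zpowersT_injective`: a finite subgroup meets a conjugate of `⟨T⟩` trivially), so each
  double coset is the union of exactly `|stab R|` cosets of `SL₂(ℤ)∕⟨T⟩` — DFI's factor `|Γ_z|⁻¹`
  in (13);
* **the decomposition of the sum over level forms by classes**:
  `sum_levelFormsUpTo_eq_sum_classReps` — `∑_{Q ∈ levelFormsUpTo} w(Q) = ∑_{R ∈ classReps Δ}
  ∑_{Q ∈ levelFormsUpTo, rep Q = R} w(Q)`, each inner range consisting of `T`-reduced level forms
  in the class of `R` (`mem_fibre_iff`), i.e. (via `dcEquiv`) of double cosets `stab R ξ ⟨T⟩` with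
  `R·ξ` a level form — for `Δ < 0` these are DFI's `P(τz)`-terms, for `Δ > 0` the closed-geodesic
  pieces.

## References

* W. Duke, J. B. Friedlander, H. Iwaniec, Ann. of Math. (2) 141 (1995), 423–441, §2 pp. 427–428
  ((12)–(14), the classes `Λ`, `Λ_{ab}` and the stability groups `Γ_z`).
  [cite: DukeFriedlanderIwaniec1995, §2 (12)–(14)]
* Á. Tóth, *Roots of quadratic congruences*, IMRN 2000, no. 14, 719–739 (positive discriminant;
  cite-only in the store). [cite: Toth2000, main theorem]
* D. A. Cox, *Primes of the form x² + ny²*, 2nd ed. (2013), §2.A, proof of Thm. 2.8 (Lagrange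
  reduction by `S` and `T^k`; here run for indefinite forms as well, where it only bounds `|A|`).
  [cite: Cox2013, Thm. 2.8 (proof)]
-/

namespace Literature.NumberTheory.Sieve

open scoped BigOperators MatrixGroups
open Finset
open Literature.NumberTheory.QuadraticFields.Quadratic (BinQF)

namespace RootForms

/-- `BinQF` is inhabited (by the zero form). [folklore] -/
instance : Nonempty BinQF := ⟨⟨0, 0, 0⟩⟩

/-! ### Non-square discriminant: `A ≠ 0`, `C ≠ 0` throughout a class -/

/-- A form of non-square discriminant has `A ≠ 0` (else `Δ = B²`). [folklore] -/
theorem a_ne_zero_of_not_isSquare {Q : BinQF} (h : ¬ IsSquare Q.disc) : Q.a ≠ 0 := by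
  intro hA
  apply h
  exact ⟨Q.b, by rw [BinQF.disc, hA]; ring⟩

/-- A form of non-square discriminant has `C ≠ 0` (else `Δ = B²`). [folklore] -/
theorem c_ne_zero_of_not_isSquare {Q : BinQF} (h : ¬ IsSquare Q.disc) : Q.c ≠ 0 := by
  intro hC
  apply h
  exact ⟨Q.b, by rw [BinQF.disc, hC]; ring⟩

/-- Non-squareness of the discriminant is a class invariant. [folklore] -/
theorem not_isSquare_smul_disc {Q : BinQF} (h : ¬ IsSquare Q.disc) (ξ : SL(2, ℤ)) :
    ¬ IsSquare (smul Q ξ).disc := by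
  rwa [smul_disc]

/-! ### Lagrange reduction (any sign) and the finiteness of the set of classes -/

/-- A form is *Lagrange-reduced* if `|B| ≤ |A| ≤ |C|`. [cite: Cox2013, Thm. 2.8 (proof)] -/
def IsLagrangeReduced (Q : BinQF) : Prop := |Q.b| ≤ |Q.a| ∧ |Q.a| ≤ |Q.c|

/-- A Lagrange-reduced form has `3A² ≤ |Δ|` (`4A² ≤ 4|AC| = |B² − Δ| ≤ B² + |Δ| ≤ A² + |Δ|`);
for `Δ < 0` this is the classical `a ≤ √(|D|/3)`, for `Δ > 0` it bounds `|A|` as well.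
[cite: Cox2013, §2.A (proof of Thm. 2.8)] -/
theorem three_mul_sq_le_of_isLagrangeReduced {Q : BinQF} (h : IsLagrangeReduced Q) :
    3 * Q.a ^ 2 ≤ |Q.disc| := by
  obtain ⟨hb, hc⟩ := h
  have h1 : Q.a ^ 2 ≤ |Q.a| * |Q.c| := by
    calc Q.a ^ 2 = |Q.a| * |Q.a| := by rw [← sq, sq_abs]
      _ ≤ |Q.a| * |Q.c| := mul_le_mul_of_nonneg_left hc (abs_nonneg _)
  have h2 : |Q.a| * |Q.c| = |Q.a * Q.c| := (abs_mul _ _).symm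
  have h3 : 4 * |Q.a * Q.c| = |Q.b ^ 2 - Q.disc| := by
    rw [BinQF.disc, show Q.b ^ 2 - (Q.b ^ 2 - 4 * Q.a * Q.c) = 4 * (Q.a * Q.c) by ring, abs_mul]
    norm_num
  have h4 : |Q.b ^ 2 - Q.disc| ≤ Q.b ^ 2 + |Q.disc| := by
    calc |Q.b ^ 2 - Q.disc| ≤ |Q.b ^ 2| + |Q.disc| := abs_sub _ _
      _ = Q.b ^ 2 + |Q.disc| := by rw [abs_of_nonneg (sq_nonneg _)]
  have h5 : Q.b ^ 2 ≤ Q.a ^ 2 := sq_le_sq.2 hb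
  nlinarith

/-- `Q·S = [C, −B, A]`. [cite: Cox2013, Thm. 2.8 (proof)] -/
theorem smul_S (Q : BinQF) : smul Q ModularGroup.S = ⟨Q.c, -Q.b, Q.a⟩ := by
  rw [← BinQF.act_S, smul]
  rfl

/-- Bringing `B` into `[−|A|, |A|)` by a power of `T` (`A ≠ 0`). [cite: Cox2013, Thm. 2.8 (proof)] -/
theorem exists_T_zpow_abs_b_le {Q : BinQF} (hA : Q.a ≠ 0) :
    ∃ k : ℤ, |(smul Q (ModularGroup.T ^ k)).b| ≤ |Q.a| := by
  set M : ℤ := 2 * |Q.a| with hM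
  have hMpos : 0 < M := by positivity
  refine ⟨-(Int.sign Q.a * ((Q.b + |Q.a|) / M)), ?_⟩
  rw [smul_T_zpow_b]
  have hsign : Q.a * Int.sign Q.a = |Q.a| := by
    rw [Int.mul_sign_self, Int.natCast_natAbs]
  have key : Q.b + 2 * Q.a * -(Int.sign Q.a * ((Q.b + |Q.a|) / M)) = (Q.b + |Q.a|) % M - |Q.a| := by
    rw [Int.emod_def]
    linear_combination (-(2 * ((Q.b + |Q.a|) / M))) * hsign
  rw [key, abs_le]
  have h0 := Int.emod_nonneg (Q.b + |Q.a|) hMpos.ne'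
  have h1 := Int.emod_lt_of_pos (Q.b + |Q.a|) hMpos
  constructor <;> linarith

/-- **Lagrange reduction for every non-square discriminant**: each form is `SL₂(ℤ)`-equivalent to
a Lagrange-reduced one (normalise `B` by `T^k`; if `|A| > |C|` apply `S`, which lowers `|A|`;
`A, C ≠ 0` throughout since `Δ` is not a square). [cite: Cox2013, Thm. 2.8 (proof)] -/
theorem exists_smul_isLagrangeReduced {Q : BinQF} (hΔ : ¬ IsSquare Q.disc) :
    ∃ ξ : SL(2, ℤ), IsLagrangeReduced (smul Q ξ) := by
  suffices H : ∀ n : ℕ, ∀ Q : BinQF, ¬ IsSquare Q.disc → Q.a.natAbs ≤ n →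
      ∃ ξ : SL(2, ℤ), IsLagrangeReduced (smul Q ξ) from H _ Q hΔ le_rfl
  intro n
  induction n using Nat.strong_induction_on with
  | _ n ih =>
    intro Q hΔ hn
    have hA : Q.a ≠ 0 := a_ne_zero_of_not_isSquare hΔ
    obtain ⟨k, hk⟩ := exists_T_zpow_abs_b_le hA
    set Q₁ := smul Q (ModularGroup.T ^ k) with hQ₁
    have hQ₁a : Q₁.a = Q.a := smul_T_zpow_a _ _
    by_cases hc : |Q₁.a| ≤ |Q₁.c|
    · exact ⟨ModularGroup.T ^ k, ⟨by rw [hQ₁a]; exact hk, hc⟩⟩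
    · push Not at hc
      set Q₂ := smul Q₁ ModularGroup.S with hQ₂
      have hQ₂eq : Q₂ = ⟨Q₁.c, -Q₁.b, Q₁.a⟩ := smul_S Q₁
      have hQ₂Δ : ¬ IsSquare Q₂.disc := by
        rw [hQ₂, smul_disc, hQ₁, smul_disc]; exact hΔ
      have hlt : Q₂.a.natAbs < n := by
        have h1 : Q₂.a = Q₁.c := by rw [hQ₂eq]
        have h2 : (Q₂.a.natAbs : ℤ) < Q.a.natAbs := by
          rw [Int.natCast_natAbs, Int.natCast_natAbs, h1, ← hQ₁a]; exact hc
        have h3 : Q₂.a.natAbs < Q.a.natAbs := by exact_mod_cast h2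
        omega
      obtain ⟨ξ', hξ'⟩ := ih _ hlt Q₂ hQ₂Δ le_rfl
      refine ⟨ModularGroup.T ^ k * ModularGroup.S * ξ', ?_⟩
      rwa [smul_mul, smul_mul]

/-- A finite set of forms of discriminant `Δ` containing a representative of every class (for `Δ`
not a square): the forms `[A, B, (B² − Δ)/(4A)]` with `|A|, |B| ≤ |Δ|` and discriminant `Δ`.
[cite: DukeFriedlanderIwaniec1995, §2 p. 427 ("the number of classes … is finite")] -/
noncomputable def classReps (Δ : ℤ) : Finset BinQF :=
  (((Finset.Icc (-|Δ|) |Δ|) ×ˢ (Finset.Icc (-|Δ|) |Δ|)).image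
      (fun p : ℤ × ℤ => (⟨p.1, p.2, (p.2 ^ 2 - Δ) / (4 * p.1)⟩ : BinQF))).filter
    (fun R => R.disc = Δ)

/-- Members of `classReps Δ` have discriminant `Δ`. [folklore] -/
theorem disc_of_mem_classReps {Δ : ℤ} {R : BinQF} (h : R ∈ classReps Δ) : R.disc = Δ :=
  (Finset.mem_filter.1 h).2

/-- A Lagrange-reduced form of non-square discriminant `Δ` lies in `classReps Δ`. [folklore] -/
theorem mem_classReps_of_isLagrangeReduced {R : BinQF} (hΔ : ¬ IsSquare R.disc)
    (h : IsLagrangeReduced R) : R ∈ classReps R.disc := by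
  have hA : R.a ≠ 0 := a_ne_zero_of_not_isSquare hΔ
  have h3 := three_mul_sq_le_of_isLagrangeReduced h
  have hA1 : 1 ≤ |R.a| := Int.one_le_abs hA
  have hAbd : |R.a| ≤ |R.disc| := by nlinarith [abs_nonneg R.a, sq_abs R.a]
  have hBbd : |R.b| ≤ |R.disc| := h.1.trans hAbd
  rw [classReps, Finset.mem_filter, Finset.mem_image]
  refine ⟨⟨(R.a, R.b), ?_, ?_⟩, rfl⟩
  · rw [Finset.mem_product, Finset.mem_Icc, Finset.mem_Icc]
    exact ⟨abs_le.1 hAbd, abs_le.1 hBbd⟩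
  · ext
    · rfl
    · rfl
    · simp only
      have hd : R.b ^ 2 - R.disc = 4 * R.a * R.c := by rw [BinQF.disc]; ring
      rw [hd, show 4 * R.a * R.c = (4 * R.a) * R.c by ring,
        Int.mul_ediv_cancel_left _ (by positivity : (4 * R.a : ℤ) ≠ 0)]

/-- **Every form of non-square discriminant is equivalent to a member of `classReps`.**
[cite: DukeFriedlanderIwaniec1995, §2 p. 427] -/
theorem exists_mem_classReps {Q : BinQF} (hΔ : ¬ IsSquare Q.disc) :
    ∃ R ∈ classReps Q.disc, ∃ ξ : SL(2, ℤ), Q = smul R ξ := by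
  obtain ⟨ξ, hred⟩ := exists_smul_isLagrangeReduced hΔ
  refine ⟨smul Q ξ, ?_, ξ⁻¹, (smul_mul_inv Q ξ).symm⟩
  have h := mem_classReps_of_isLagrangeReduced (not_isSquare_smul_disc hΔ ξ) hred
  rwa [smul_disc] at h

/-- **The canonical representative of the class of `Q`** (a choice, constant on classes:
`rep_smul`). [folklore] -/
noncomputable def rep (Q : BinQF) : BinQF :=
  Classical.epsilon (fun R : BinQF => R ∈ classReps Q.disc ∧ ∃ ξ : SL(2, ℤ), Q = smul R ξ)

/-- `rep Q ∈ classReps (disc Q)` and `Q = (rep Q)·ξ` for some `ξ` (non-square discriminant). [folklore] -/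
theorem rep_spec {Q : BinQF} (hΔ : ¬ IsSquare Q.disc) :
    rep Q ∈ classReps Q.disc ∧ ∃ ξ : SL(2, ℤ), Q = smul (rep Q) ξ := by
  obtain ⟨R, hR, ξ, h⟩ := exists_mem_classReps hΔ
  exact Classical.epsilon_spec (p := fun R : BinQF => R ∈ classReps Q.disc ∧ ∃ ξ : SL(2, ℤ),
    Q = smul R ξ) ⟨R, hR, ξ, h⟩

/-- `rep` is a class function: `rep (Q·γ) = rep Q`. [folklore] -/
theorem rep_smul (Q : BinQF) (γ : SL(2, ℤ)) : rep (smul Q γ) = rep Q := by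
  unfold rep
  have hP : (fun R : BinQF => R ∈ classReps (smul Q γ).disc ∧ ∃ ξ : SL(2, ℤ), smul Q γ = smul R ξ) =
      (fun R : BinQF => R ∈ classReps Q.disc ∧ ∃ ξ : SL(2, ℤ), Q = smul R ξ) := by
    funext R
    rw [smul_disc]
    apply propext
    refine and_congr_right fun _ => ⟨?_, ?_⟩
    · rintro ⟨ξ, h⟩
      exact ⟨ξ * γ⁻¹, by rw [smul_mul, ← h, smul_mul_inv]⟩
    · rintro ⟨ξ, h⟩
      exact ⟨ξ * γ, by rw [smul_mul, ← h]⟩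
  rw [hP]

/-- `disc (rep Q) = disc Q` (non-square discriminant). [folklore] -/
theorem rep_disc {Q : BinQF} (hΔ : ¬ IsSquare Q.disc) : (rep Q).disc = Q.disc :=
  disc_of_mem_classReps (rep_spec hΔ).1

/-- `(rep Q).a ≠ 0` (non-square discriminant). [folklore] -/
theorem rep_a_ne_zero {Q : BinQF} (hΔ : ¬ IsSquare Q.disc) : (rep Q).a ≠ 0 :=
  a_ne_zero_of_not_isSquare (by rw [rep_disc hΔ]; exact hΔ)

/-! ### Stabilisers -/

/-- The stabiliser `stab R = {s ∈ SL₂(ℤ) : R·s = R}` of a form (DFI's `Γ_z`, the stability group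
of the Heegner point, for `Δ < 0`; infinite cyclic modulo `±1` for `Δ > 0`).
[cite: DukeFriedlanderIwaniec1995, §2 p. 427] -/
def stab (R : BinQF) : Subgroup SL(2, ℤ) where
  carrier := {s | smul R s = R}
  one_mem' := smul_one R
  mul_mem' := by
    intro s t hs ht
    simp only [Set.mem_setOf_eq] at hs ht ⊢
    rw [smul_mul, hs, ht]
  inv_mem' := by
    intro s hs
    simp only [Set.mem_setOf_eq] at hs ⊢
    conv_lhs => rw [← hs]
    rw [smul_mul_inv]

/-- Membership in the stabiliser. [folklore] -/
theorem mem_stab_iff {R : BinQF} {s : SL(2, ℤ)} : s ∈ stab R ↔ smul R s = R := Iff.rfl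

/-- `−1` stabilises every form. [folklore] -/
theorem neg_one_mem_stab (R : BinQF) : -1 ∈ stab R := by
  rw [mem_stab_iff, smul_neg, smul_one]

/-- `R·ξ = R·ξ' ↔ ξ'ξ⁻¹ ∈ stab R`. [folklore] -/
theorem smul_eq_smul_iff {R : BinQF} {ξ ξ' : SL(2, ℤ)} :
    smul R ξ = smul R ξ' ↔ ξ' * ξ⁻¹ ∈ stab R := by
  rw [mem_stab_iff, smul_mul]
  constructor
  · intro h
    rw [← h, smul_mul_inv]
  · intro h
    have h' := congrArg (fun Q => smul Q ξ) h
    simp only [smul_inv_mul] at h'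
    exact h'.symm

/-- The stabiliser of `R·ξ` is the conjugate `ξ⁻¹ (stab R) ξ`. [folklore] -/
theorem mem_stab_smul_iff {R : BinQF} {ξ s : SL(2, ℤ)} :
    s ∈ stab (smul R ξ) ↔ ξ * s * ξ⁻¹ ∈ stab R := by
  rw [mem_stab_iff, mem_stab_iff, ← smul_mul, smul_mul R (ξ * s) ξ⁻¹]
  constructor
  · intro h
    rw [h, smul_mul_inv]
  · intro h
    have h' := congrArg (fun Q => smul Q ξ) h
    simp only [smul_inv_mul] at h'
    exact h'

/-! ### `T`-reduction as a map and `Γ∞`-classes as double cosets -/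

/-- The subgroup `⟨T⟩ = {T^k}` (translations; `Γ∞` up to sign). [folklore] -/
abbrev zpowersT : Subgroup SL(2, ℤ) := Subgroup.zpowers ModularGroup.T

/-- The `T`-reduced translate `tred Q = Q·T^{tExp Q}`. [folklore] -/
noncomputable def tred (Q : BinQF) : BinQF := smul Q (ModularGroup.T ^ tExp Q)

/-- `tred Q` is `T`-reduced (`A ≠ 0`). [folklore] -/
theorem isTReduced_tred {Q : BinQF} (hA : Q.a ≠ 0) : IsTReduced (tred Q) :=
  isTReduced_smul_T_zpow_tExp hA

/-- `(tred Q).a = Q.a`. [folklore] -/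
@[simp] theorem tred_a (Q : BinQF) : (tred Q).a = Q.a := smul_T_zpow_a _ _

/-- `tred` is constant on `⟨T⟩`-orbits (`A ≠ 0`). [folklore] -/
theorem tred_smul_T_zpow {Q : BinQF} (hA : Q.a ≠ 0) (k : ℤ) :
    tred (smul Q (ModularGroup.T ^ k)) = tred Q := by
  unfold tred
  rw [← smul_mul, ← zpow_add]
  have hA' : (smul Q (ModularGroup.T ^ k)).a ≠ 0 := by rwa [smul_T_zpow_a]
  have h1 : IsTReduced (smul Q (ModularGroup.T ^ (k + tExp (smul Q (ModularGroup.T ^ k))))) := by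
    rw [zpow_add, smul_mul]
    exact isTReduced_smul_T_zpow_tExp hA'
  rw [T_zpow_unique hA h1 (isTReduced_smul_T_zpow_tExp hA)]

/-- `tred` is constant on `⟨T⟩`-orbits, subgroup form. [folklore] -/
theorem tred_smul_of_mem_zpowersT {Q : BinQF} (hA : Q.a ≠ 0) {t : SL(2, ℤ)} (ht : t ∈ zpowersT) :
    tred (smul Q t) = tred Q := by
  obtain ⟨k, rfl⟩ := Subgroup.mem_zpowers_iff.1 ht
  exact tred_smul_T_zpow hA k

/-- A `T`-reduced form is its own `tred`. [folklore] -/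
theorem tred_eq_self {Q : BinQF} (hA : Q.a ≠ 0) (h : IsTReduced Q) : tred Q = Q := by
  rw [tred, tExp_eq_zero_of_isTReduced hA h, zpow_zero, smul_one]

/-- `tred Q = tred Q' ↔ Q' = Q·T^k` for some `k` (`A ≠ 0`). [folklore] -/
theorem tred_eq_tred_iff {Q Q' : BinQF} (hA : Q.a ≠ 0) (hA' : Q'.a ≠ 0) :
    tred Q = tred Q' ↔ ∃ k : ℤ, Q' = smul Q (ModularGroup.T ^ k) := by
  constructor
  · intro h
    refine ⟨tExp Q - tExp Q', ?_⟩
    have h1 : smul (tred Q) (ModularGroup.T ^ (-tExp Q')) = smul (tred Q') (ModularGroup.T ^ (-tExp Q')) := by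
      rw [h]
    rw [tred, tred, ← smul_mul, ← smul_mul, ← zpow_add, ← zpow_add, add_neg_cancel, zpow_zero,
      smul_one] at h1
    rw [sub_eq_add_neg]
    exact h1.symm
  · rintro ⟨k, rfl⟩
    exact (tred_smul_T_zpow hA k).symm

/-- The `T`-reduced forms in the class of `R`. [folklore] -/
def ClassTRed (R : BinQF) : Type :=
  {Q : BinQF // (∃ ξ : SL(2, ℤ), Q = smul R ξ) ∧ IsTReduced Q}

/-- The map `ξ ↦ tred (R·ξ)` is constant on double cosets `stab R · ξ · ⟨T⟩`. [folklore] -/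
theorem tred_smul_eq_of_rel {R : BinQF} (hΔ : ¬ IsSquare R.disc) {ξ ξ' : SL(2, ℤ)}
    (h : DoubleCoset.setoid (stab R : Set SL(2, ℤ)) (zpowersT : Set SL(2, ℤ)) ξ ξ') :
    tred (smul R ξ) = tred (smul R ξ') := by
  obtain ⟨s, hs, t, ht, rfl⟩ := DoubleCoset.rel_iff.1 h
  rw [smul_mul, smul_mul, mem_stab_iff.1 hs,
    tred_smul_of_mem_zpowersT (a_ne_zero_of_not_isSquare (not_isSquare_smul_disc hΔ ξ)) ht]

/-- Conversely `tred (R·ξ) = tred (R·ξ')` forces `ξ' ∈ stab R · ξ · ⟨T⟩`. [folklore] -/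
theorem rel_of_tred_smul_eq {R : BinQF} (hΔ : ¬ IsSquare R.disc) {ξ ξ' : SL(2, ℤ)}
    (h : tred (smul R ξ) = tred (smul R ξ')) :
    DoubleCoset.setoid (stab R : Set SL(2, ℤ)) (zpowersT : Set SL(2, ℤ)) ξ ξ' := by
  have hA : (smul R ξ).a ≠ 0 := a_ne_zero_of_not_isSquare (not_isSquare_smul_disc hΔ ξ)
  have hA' : (smul R ξ').a ≠ 0 := a_ne_zero_of_not_isSquare (not_isSquare_smul_disc hΔ ξ')
  obtain ⟨k, hk⟩ := (tred_eq_tred_iff hA hA').1 h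
  rw [← smul_mul] at hk
  -- `R·ξ' = R·(ξ T^k)`, so `ξ' (ξ T^k)⁻¹ ∈ stab R`
  have hs : ξ' * (ξ * ModularGroup.T ^ k)⁻¹ ∈ stab R := (smul_eq_smul_iff.1 hk.symm)
  refine DoubleCoset.rel_iff.2 ⟨ξ' * (ξ * ModularGroup.T ^ k)⁻¹, hs, ModularGroup.T ^ k,
    Subgroup.mem_zpowers_iff.2 ⟨k, rfl⟩, ?_⟩
  group

/-- **`Γ∞`-classes in a class as double cosets.**  For `R` of non-square discriminant,
`ξ ↦ tred (R·ξ)` is a bijection from `stab R ∖ SL₂(ℤ) ∕ ⟨T⟩` onto the `T`-reduced forms of the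
class of `R` (DFI: the forms of a class are the `σ`-translates, `σ ∈ Γ_z∖Γ`, grouped modulo
`Γ∞`). [cite: DukeFriedlanderIwaniec1995, §2 pp. 427–428] -/
noncomputable def dcEquiv (R : BinQF) (hΔ : ¬ IsSquare R.disc) :
    DoubleCoset.Quotient (stab R : Set SL(2, ℤ)) (zpowersT : Set SL(2, ℤ)) ≃ ClassTRed R := by
  refine Equiv.ofBijective
    (Quotient.lift (s := DoubleCoset.setoid (stab R : Set SL(2, ℤ)) (zpowersT : Set SL(2, ℤ)))
      (fun ξ : SL(2, ℤ) => (⟨tred (smul R ξ),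
        ⟨ξ * ModularGroup.T ^ tExp (smul R ξ), by rw [smul_mul]; rfl⟩,
        isTReduced_tred (a_ne_zero_of_not_isSquare (not_isSquare_smul_disc hΔ ξ))⟩ : ClassTRed R))
      (fun ξ ξ' h => Subtype.ext (tred_smul_eq_of_rel hΔ h))) ⟨?_, ?_⟩
  · -- injective
    intro x y hxy
    induction x using Quotient.inductionOn with
    | h ξ =>
      induction y using Quotient.inductionOn with
      | h ξ' =>
        have h := congrArg Subtype.val hxy
        exact Quotient.sound (rel_of_tred_smul_eq hΔ h)
  · -- surjective
    rintro ⟨Q, ⟨ξ, rfl⟩, hT⟩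
    refine ⟨Quotient.mk _ ξ, Subtype.ext ?_⟩
    exact tred_eq_self (a_ne_zero_of_not_isSquare (not_isSquare_smul_disc hΔ ξ)) hT

/-- The form attached to the double coset of `ξ` is `tred (R·ξ)`. [folklore] -/
@[simp] theorem dcEquiv_mk (R : BinQF) (hΔ : ¬ IsSquare R.disc) (ξ : SL(2, ℤ)) :
    (dcEquiv R hΔ (DoubleCoset.mk (stab R) zpowersT ξ)).1 = tred (smul R ξ) :=
  rfl

/-! ### Finite stabilisers act freely on `SL₂(ℤ) ∕ ⟨T⟩` -/

/-- `T^k = 1` only for `k = 0`. [folklore] -/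
theorem T_zpow_eq_one_iff {k : ℤ} : ModularGroup.T ^ k = 1 ↔ k = 0 := by
  constructor
  · intro h
    have := congrArg (fun g : SL(2, ℤ) => g 0 1) h
    simpa [ModularGroup.coe_T_zpow] using this
  · rintro rfl
    exact zpow_zero _

/-- A finite subgroup meets every conjugate of `⟨T⟩` trivially: if `ξ t ξ⁻¹` has finite order for
`t ∈ ⟨T⟩` then `t = 1`. [folklore] -/
theorem eq_one_of_mem_zpowersT_of_isOfFinOrder {t : SL(2, ℤ)} (ht : t ∈ zpowersT)
    (hfin : IsOfFinOrder t) : t = 1 := by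
  obtain ⟨k, rfl⟩ := Subgroup.mem_zpowers_iff.1 ht
  obtain ⟨n, hn, h1⟩ := hfin.exists_pow_eq_one
  rw [← zpow_natCast, ← zpow_mul, T_zpow_eq_one_iff] at h1
  have hk : k = 0 := by
    rcases mul_eq_zero.1 h1 with h | h
    · exact h
    · exfalso; exact hn.ne' (by exact_mod_cast h)
  rw [hk, zpow_zero]

/-- Elements of a finite subgroup have finite order. [folklore] -/
theorem isOfFinOrder_of_mem_of_finite (H : Subgroup SL(2, ℤ)) [Finite H] {u : SL(2, ℤ)}
    (hu : u ∈ H) : IsOfFinOrder u := by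
  obtain ⟨n, hn, h1⟩ := (isOfFinOrder_of_finite (⟨u, hu⟩ : H)).exists_pow_eq_one
  refine isOfFinOrder_iff_pow_eq_one.2 ⟨n, hn, ?_⟩
  have h2 := congrArg Subtype.val h1
  simpa using h2

/-- **Free action of a finite stabiliser on `SL₂(ℤ) ∕ ⟨T⟩`**: for a finite subgroup `H` (e.g.
`stab R` of a definite form) and any `ξ`, `s ↦ sξ⟨T⟩` is injective on `H`; hence the double coset
`H ξ ⟨T⟩` is the disjoint union of exactly `|H|` left cosets of `⟨T⟩` (DFI's normalisation
`|Γ_z|⁻¹ ∑_{σ ∈ Γ∞∖Γ}` in (13)). [cite: DukeFriedlanderIwaniec1995, (13) p. 428] -/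
theorem mul_mk_zpowersT_injective (H : Subgroup SL(2, ℤ)) [Finite H] (ξ : SL(2, ℤ)) :
    Function.Injective (fun s : H => (((s : SL(2, ℤ)) * ξ : SL(2, ℤ)) : SL(2, ℤ) ⧸ zpowersT)) := by
  intro s s' h
  -- `u = s⁻¹ s' ∈ H` and `ξ⁻¹ u ξ ∈ ⟨T⟩`
  obtain ⟨u, hu⟩ : ∃ u : SL(2, ℤ), (s : SL(2, ℤ))⁻¹ * s' = u := ⟨_, rfl⟩
  have huH : u ∈ H := hu ▸ H.mul_mem (H.inv_mem s.2) s'.2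
  have h1 : ((s : SL(2, ℤ)) * ξ)⁻¹ * ((s' : SL(2, ℤ)) * ξ) ∈ zpowersT := QuotientGroup.eq.1 h
  have hconj : ((s : SL(2, ℤ)) * ξ)⁻¹ * ((s' : SL(2, ℤ)) * ξ) = ξ⁻¹ * u * ξ⁻¹⁻¹ := by
    rw [← hu]
    simp only [mul_inv_rev, inv_inv, mul_assoc]
  rw [hconj] at h1
  obtain ⟨k, hk⟩ := Subgroup.mem_zpowers_iff.1 h1
  -- `u` has finite order (an element of the finite group `H`), hence so has `T^k = ξ⁻¹ u ξ`
  obtain ⟨n, hn, hun⟩ := (isOfFinOrder_of_mem_of_finite H huH).exists_pow_eq_one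
  have hTkn : ModularGroup.T ^ (k * n) = 1 := by
    rw [zpow_mul, zpow_natCast, hk, conj_pow, hun, mul_one, mul_inv_cancel]
  have hk0 : k = 0 := by
    rcases mul_eq_zero.1 (T_zpow_eq_one_iff.1 hTkn) with h0 | h0
    · exact h0
    · exfalso; exact hn.ne' (by exact_mod_cast h0)
  -- so `ξ⁻¹ u ξ = 1`, `u = 1`, `s = s'`
  have hu1 : u = 1 := by
    have e : ξ⁻¹ * u * ξ⁻¹⁻¹ = 1 := by rw [← hk, hk0, zpow_zero]
    exact conj_eq_one_iff.1 e
  rw [hu1, inv_mul_eq_one] at hu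
  exact Subtype.ext hu

/-- Consequently, for finite `stab R`, the fibre of `SL₂(ℤ)∕⟨T⟩ → stab R ∖ SL₂(ℤ) ∕ ⟨T⟩` over the
double coset of `ξ` — the cosets `sξ⟨T⟩`, `s ∈ stab R` — has exactly `|stab R|` elements.
[cite: DukeFriedlanderIwaniec1995, (13) p. 428] -/
theorem ncard_fibre_eq (H : Subgroup SL(2, ℤ)) [Finite H] (ξ : SL(2, ℤ)) :
    (Set.range (fun s : H => (((s : SL(2, ℤ)) * ξ : SL(2, ℤ)) : SL(2, ℤ) ⧸ zpowersT))).ncard =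
      Nat.card H := by
  rw [Set.ncard_range_of_injective (mul_mk_zpowersT_injective H ξ)]

/-- The fibre description: `y ∈ SL₂(ℤ)∕⟨T⟩` lies over the double coset of `ξ` iff `y = sξ⟨T⟩` for
some `s ∈ H`. [folklore] -/
theorem mk_doubleCoset_eq_iff (H : Subgroup SL(2, ℤ)) (ξ η : SL(2, ℤ)) :
    DoubleCoset.mk H zpowersT η = DoubleCoset.mk H zpowersT ξ ↔
      ∃ s : H, (((s : SL(2, ℤ)) * ξ : SL(2, ℤ)) : SL(2, ℤ) ⧸ zpowersT) = η := by
  rw [DoubleCoset.eq]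
  constructor
  · rintro ⟨h, hh, k, hk, hξ⟩
    refine ⟨⟨h⁻¹, H.inv_mem hh⟩, ?_⟩
    rw [QuotientGroup.eq]
    have e : ((h⁻¹ : SL(2, ℤ)) * ξ)⁻¹ * η = k⁻¹ := by rw [hξ]; group
    rw [show ((⟨h⁻¹, H.inv_mem hh⟩ : H) : SL(2, ℤ)) = h⁻¹ from rfl, e]
    exact zpowersT.inv_mem hk
  · rintro ⟨s, h⟩
    have ht : ((s : SL(2, ℤ)) * ξ)⁻¹ * η ∈ zpowersT := QuotientGroup.eq.1 h
    refine ⟨(s : SL(2, ℤ))⁻¹, H.inv_mem s.2, (((s : SL(2, ℤ)) * ξ)⁻¹ * η)⁻¹,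
      zpowersT.inv_mem ht, ?_⟩
    group

/-! ### The sum over level forms decomposed by classes -/

section classes

variable {a b c : ℤ} {d N : ℕ}

/-- Level forms built from `aX² + bX + c` have the (non-square) discriminant `b² − 4ac`. [folklore] -/
theorem not_isSquare_disc_of_mem_levelFormsUpTo (ha : 0 < a) (hΔ : ¬ IsSquare (discrim a b c))
    {Q : BinQF} (hQ : Q ∈ levelFormsUpTo a b c d N) : ¬ IsSquare Q.disc := by
  rw [((mem_levelFormsUpTo ha).1 hQ).1.disc_eq]; exact hΔ

/-- The class representative of a level form lies in the fixed finite set `classReps (b² − 4ac)`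
(independent of `d`, `N`, `h`). [cite: DukeFriedlanderIwaniec1995, §2 p. 428 ("the number of points in `Λ_{ab}` is bounded by a constant which depends only on `a`, `D`")] -/
theorem rep_mem_classReps_of_mem (ha : 0 < a) (hΔ : ¬ IsSquare (discrim a b c)) {Q : BinQF}
    (hQ : Q ∈ levelFormsUpTo a b c d N) : rep Q ∈ classReps (discrim a b c) := by
  have h := (rep_spec (not_isSquare_disc_of_mem_levelFormsUpTo ha hΔ hQ)).1
  rwa [((mem_levelFormsUpTo ha).1 hQ).1.disc_eq] at h

/-- **The sum over level forms, decomposed by `SL₂(ℤ)`-classes** (finitely many, indexed by the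
fixed set `classReps (b² − 4ac)`):
`∑_{Q ∈ levelFormsUpTo} w(Q) = ∑_{R ∈ classReps Δ} ∑_{Q ∈ levelFormsUpTo, rep Q = R} w(Q)`.
Combined with `sum_weylSum_eq_sum_levelForms` this is the class-by-class form of DFI's (14)
(before each class sum is recognised as values / cycle integrals of a Poincaré series).
[cite: DukeFriedlanderIwaniec1995, (14) p. 428] -/
theorem sum_levelFormsUpTo_eq_sum_classReps {M : Type*} [AddCommMonoid M] (ha : 0 < a)
    (hΔ : ¬ IsSquare (discrim a b c)) (w : BinQF → M) :
    ∑ Q ∈ levelFormsUpTo a b c d N, w Q =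
      ∑ R ∈ classReps (discrim a b c),
        ∑ Q ∈ (levelFormsUpTo a b c d N).filter (fun Q => rep Q = R), w Q :=
  (Finset.sum_fiberwise_of_maps_to (fun _ hQ => rep_mem_classReps_of_mem ha hΔ hQ) w).symm

/-- Membership in a class fibre: `Q` is a `T`-reduced level form of level `ad` with
`0 < A ≤ aN`, lying in the class of `R = rep Q` (`Q = R·ξ`). [cite: DukeFriedlanderIwaniec1995, §2 pp. 427–428] -/
theorem mem_fibre_iff (ha : 0 < a) {R Q : BinQF} :
    Q ∈ (levelFormsUpTo a b c d N).filter (fun Q' => rep Q' = R) ↔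
      (IsLevelForm a b (discrim a b c) (a.toNat * d) Q ∧ 0 < Q.a ∧ Q.a ≤ a * N ∧ IsTReduced Q) ∧
        rep Q = R := by
  rw [Finset.mem_filter, mem_levelFormsUpTo ha]

/-- A form in the fibre over `R` is `R·ξ` for some `ξ ∈ SL₂(ℤ)`. [folklore] -/
theorem exists_smul_eq_of_mem_fibre (ha : 0 < a) (hΔ : ¬ IsSquare (discrim a b c)) {R Q : BinQF}
    (hQ : Q ∈ (levelFormsUpTo a b c d N).filter (fun Q => rep Q = R)) :
    ∃ ξ : SL(2, ℤ), Q = smul R ξ := by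
  obtain ⟨hQ', hrep⟩ := Finset.mem_filter.1 hQ
  rw [← hrep]
  exact (rep_spec (not_isSquare_disc_of_mem_levelFormsUpTo ha hΔ hQ')).2

/-- The fibre over `R` embeds into the `T`-reduced forms of the class of `R` (hence, by `dcEquiv`,
into `stab R ∖ SL₂(ℤ) ∕ ⟨T⟩`). [folklore] -/
def fibreEmb (ha : 0 < a) (hΔ : ¬ IsSquare (discrim a b c)) (R : BinQF) :
    {Q : BinQF // Q ∈ (levelFormsUpTo a b c d N).filter (fun Q => rep Q = R)} → ClassTRed R :=
  fun Q => ⟨Q.1, exists_smul_eq_of_mem_fibre ha hΔ Q.2,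
    ((mem_fibre_iff (R := R) ha).1 Q.2).1.2.2.2⟩

/-- `fibreEmb` is injective (it is the identity on underlying forms). [folklore] -/
theorem fibreEmb_injective (ha : 0 < a) (hΔ : ¬ IsSquare (discrim a b c)) (R : BinQF) :
    Function.Injective (fibreEmb (d := d) (N := N) ha hΔ R) := by
  intro Q Q' h
  exact Subtype.ext (congrArg (fun x : ClassTRed R => x.1) h)

/-- The underlying form of `fibreEmb`. [folklore] -/
@[simp] theorem fibreEmb_val (ha : 0 < a) (hΔ : ¬ IsSquare (discrim a b c)) (R : BinQF)
    (Q : {Q : BinQF // Q ∈ (levelFormsUpTo a b c d N).filter (fun Q => rep Q = R)}) :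
    (fibreEmb ha hΔ R Q).1 = Q.1 := rfl

/-- For a level form `R·ξ` of level `q` (any representative of its double coset), `q` divides
`(R·ξ).a`: the double cosets met by level forms lie over level cosets `ξΓ₀(q)` in the sense of
`QuadraticRootsLevelCosets.lean`. [cite: DukeFriedlanderIwaniec1995, §2 p. 428] -/
theorem level_dvd_smul_a_of_isLevelForm {Δ : ℤ} {q : ℕ} {R : BinQF} {ξ : SL(2, ℤ)}
    (h : IsLevelForm a b Δ q (smul R ξ)) : (q : ℤ) ∣ (smul R ξ).a :=
  h.level_dvd

/-- The level property is constant on double cosets `stab R · ξ · ⟨T⟩` when `a ∣ q`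
(`T ∈ Γ₀(q)`). [folklore] -/
theorem isLevelForm_smul_of_rel {Δ : ℤ} {q : ℕ} (haq : a ∣ (q : ℤ)) {R : BinQF} {ξ ξ' : SL(2, ℤ)}
    (hrel : DoubleCoset.setoid (stab R : Set SL(2, ℤ)) (zpowersT : Set SL(2, ℤ)) ξ ξ')
    (h : IsLevelForm a b Δ q (smul R ξ)) : IsLevelForm a b Δ q (smul R ξ') := by
  obtain ⟨s, hs, t, ht, rfl⟩ := DoubleCoset.rel_iff.1 hrel
  rw [smul_mul, smul_mul, mem_stab_iff.1 hs]
  obtain ⟨k, rfl⟩ := Subgroup.mem_zpowers_iff.1 ht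
  refine h.smul haq (Subgroup.zpow_mem _ ?_ k)
  rw [CongruenceSubgroup.Gamma0_mem]
  simp [ModularGroup.T]

end classes

end RootForms

end Literature.NumberTheory.Sieve
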